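import Summits.BirchSwinnertonDyer.BirchSwinnertonDyer.Theses.SignedBaseChange
import Summits.BirchSwinnertonDyer.BirchSwinnertonDyer.Theorems.SignedBaseChangeTwistPairGreenbergProductDivisibilitySplitAcanchorGlue
import Summits.BirchSwinnertonDyer.BirchSwinnertonDyer.Theorems.BiquadraticEisensteinDescentHeegnerFieldSupplyEvenRung
import HarnessLib

/-!
# Crux `AnticyclotomicEisensteinDivisibility` (stmt-BirchSwinnertonDyer-20727, route SignedBaseChange), line `bdpline`:
# the `p ∣ h_K` cell is OFF THE ROUTE'S CRITICAL PATH — the parent K1″ `TwistPairGreenbergProductDivisibilityCanonical`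
# from the two-variable Euler-system inclusion (ES) and the crux WITH THE EXTRA BINDER `¬ p ∣ h_K` (AED⁺), because the
# frame field `K` of K1″ can be chosen with `2` split AND `p ∤ h_K` (Beckwith–Raum–Richter 2022 Thm. 1, in the tree)

Width seat `bsd-line-sbc-p1-w2` (gen 7), cell `bsd-ssimc`; helper `--supports stmt-BirchSwinnertonDyer-20727`. THEOREMS ONLY
(0 definitions, 0 named facts, 0 `sorry`); statement texts BY VALUE.

WHY. The registered skeleton `Cruxes/AnticyclotomicEisensteinDivisibility/Lines/bdpline.lean` (v26, sha16 cbc89a6ac92fac24) has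
four open stubs; two of them — (a2) `stub_xAcTorsionSS_classDvd` and S1∣ `stub_bdpLowerHalfRatSS_classDvd` — exist ONLY on the cell
`p ∣ h_K` (no anticyclotomic signed theory in print there: every source carries `AcSigned.Setting.not_dvd_classNumber`). The crux
quantifies over EVERY Heegner field `K`, but its parent K1″ (stmt-BirchSwinnertonDyer-20519) quantifies `K` EXISTENTIALLY: the landed
glue `SignedBaseChangeK1Acanchor.twistPairGreenbergProductDivisibilityCanonical_of_eulerSystem_of_anchor` (p534867/p536497) feeds
the crux at the field of FD″ (`SignedBaseChangeK1FrameDataCanonical.stub_frameDataBCSsplit_canonical`, `K = ℚ(√−q)`, `q` prime),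
whose class number is not controlled. The earlier width finding (w2 gen 6, 2026-08-28T14:04Z: "no refereed theorem prescribes the
prime 2 together with p ∤ h_K") overlooked the tree's own
`BiquadraticEisensteinDescentHeegnerFieldSupplyEvenRung.exists_twoSplit_split_not_dvd_classNumber` (seat bsd-wall-bed-p2 g7): for a
prime `ℓ > 3`, any finite set of ODD primes and any bound, an imaginary quadratic `K` with `d_K ≡ 1 (mod 8)` (so `2` splits, `d_K` is
odd and `≠ −3`), the given primes split and `ℓ ∤ h_K` — PROVED modulo the refereed named fact
`Literature.NumberTheory.QuadraticFields.BRR2022_thm_1` (Beckwith–Raum–Richter, Adv. Math. 409 (2022), Thm. 1: a Ramanujan-type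
congruence `H(an+b) ≡ 0 (mod ℓ)` with `−b` a square mod `a` forces `ℓ ∣ b`).

THIS FILE.
* §1 two reading lemmas on quadratic fields (a split odd prime does not divide `d_K`; `(N, d_K) = 1` when every prime of `N`
  splits and `d_K` is odd).
* §2 **FD‴** `frameDataBCSsplit_canonical_coprime`: the statement of FD″ VERBATIM with ONE extra conjunct `¬ p ∣ NumberField.classNumber K`
  appended, granted `BRR2022_thm_1` (proof = FD″'s, p533831, with the K-supply swapped; the twist prime `ℓ ≡ 1 (mod 8)` is chosen
  first, exactly as there).
* §3 **K1″ ⇐ ES ∧ AED⁺** modulo {BCS 2025 Prop. 4.2.2 (guarded, = conjunct 1 of `SignedTwoVariableInputs`), BRR 2022 Thm. 1}: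
  `twistPairGreenbergProductDivisibilityCanonical_of_eulerSystem_of_acDivCoprime` — the composition of p536497 §5 with FD‴ and the
  binder `¬ p ∣ h_K` threaded — and the closer-shaped `twistPairGreenbergProductDivisibilityCanonical_of_acDivCoprime`:
  `BRR2022_thm_1 → AED⁺ → TwoVariableEulerSystemDivisibility → TwistPairGreenbergProductDivisibilityCanonical`, where **AED⁺ is the
  crux text with `¬ p ∣ NumberField.classNumber K →` inserted after `κ₂.IsAnticyclotomic →`** (antecedent `SignedTwoVariableInputs`
  by name, δ-equal to the crux's by-value conjunction).
CONSEQUENCE (for the planner, not enacted here): restating stmt-BirchSwinnertonDyer-20727 as AED⁺ keeps the route's glue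
(this file replaces `SignedBaseChangeAcanchorGlueCloser` for the restated text, at the price of the one refereed fact BRR 2022) and
deletes the two `p ∣ h_K` stubs from line `bdpline` (4 → 2: `stub_namedFactsSS`, `stub_signedEisensteinSS_coprime`); the sequel file
`…CoprimeClassNumberComposition` derives AED⁺ from exactly those two. CONDITIONAL on the displayed hypotheses; nothing is asserted
about ES, AED⁺ or BSD. No summit statement is proved by this file.

References: [BeckwithRaumRichter2022] Adv. Math. 409 (2022) 108663, Thm. 1; [BurungaleCastellaSkinner2025] IMRN 2025, Prop. 4.2.2;
the crux-strategist's line `acanchor` (p534867/p536497) and FD″ (p533831).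
-/

-- D-0017: single-problem summit, the namespace repeats the problem name by design.
set_option linter.dupNamespace false
set_option autoImplicit false

noncomputable section

open scoped Classical NumberField
open NumberField IsDedekindDomain Field WeierstrassCurve Module
open Literature.NumberTheory.EllipticCurves Literature.NumberTheory.GaloisRepresentations
  Literature.NumberTheory.EllipticCurves.ModularForms
open Literature.NumberTheory.QuadraticFields Literature.NumberTheory.QuadraticFields.Quadratic
open Summit.BirchSwinnertonDyer.BirchSwinnertonDyer.Theorems.SignedBaseChangeK1FrameData
open Summit.BirchSwinnertonDyer.BirchSwinnertonDyer.Theorems.SignedBaseChangeK1FrameDataBCS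
open Summit.BirchSwinnertonDyer.BirchSwinnertonDyer.Theorems.SignedBaseChangeK1FrameDataCanonical
open Summit.BirchSwinnertonDyer.BirchSwinnertonDyer.Theorems.SignedBaseChangeK1Acanchor
open Summit.BirchSwinnertonDyer.BirchSwinnertonDyer.Theses.SignedBaseChange

namespace Summit.BirchSwinnertonDyer.BirchSwinnertonDyer.Theorems.SignedBaseChangeAcDivCoprimeClassNumber

/-! ## §1 Reading lemmas: split odd primes do not divide `d_K`; `(N, d_K) = 1` -/

/-- In a quadratic field, an odd prime `q` that splits (two primes above it) does not divide the discriminant: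
the Kronecker/Jacobi symbol `(d_K/q)` is `1`, not `0`. [cite: Cox2013, Prop. 5.16 / Cor. 5.17 (decomposition law)] -/
theorem not_intCast_dvd_discr_of_ncard_primesOver_eq_two {K : Type} [Field K] [NumberField K]
    (h2 : finrank ℚ K = 2) {q : ℕ} (hq : q.Prime) (hq2 : q ≠ 2)
    (hsplit : ((Ideal.span {(q : ℤ)}).primesOver (𝓞 K)).ncard = 2) :
    ¬ (q : ℤ) ∣ NumberField.discr K := by
  intro hdvd
  have hj1 : jacobiSym (NumberField.discr K) q = 1 := (ncard_primesOver_eq_two_iff_jacobiSym h2 hq hq2).mp hsplit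
  rw [jacobiSym.mod_left, Int.emod_eq_zero_of_dvd hdvd, jacobiSym.zero_left hq.one_lt] at hj1
  exact zero_ne_one hj1

/-- `(N, d_K) = 1` as soon as `d_K` is odd and every prime factor of `N` splits in the quadratic field `K`.
[cite: Cox2013, Cor. 5.17 (decomposition law)] -/
theorem isCoprime_natCast_discr_of_forall_split {K : Type} [Field K] [NumberField K] (h2 : finrank ℚ K = 2)
    {N : ℕ} (hodd : Odd (NumberField.discr K))
    (hsplit : ∀ l : ℕ, l.Prime → l ∣ N → ((Ideal.span {(l : ℤ)}).primesOver (𝓞 K)).ncard = 2) :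
    IsCoprime (N : ℤ) (NumberField.discr K) := by
  rw [Int.isCoprime_iff_gcd_eq_one, Int.gcd_eq_natAbs, Int.natAbs_natCast]
  refine (Nat.coprime_of_dvd fun k hk hkN hkD ↦ ?_ : Nat.Coprime N (NumberField.discr K).natAbs)
  by_cases hk2 : k = 2
  · subst hk2
    exact (Nat.not_even_iff_odd.mpr (Int.natAbs_odd.mpr hodd)) (even_iff_two_dvd.mpr hkD)
  · exact not_intCast_dvd_discr_of_ncard_primesOver_eq_two h2 hk hk2 (hsplit k hk hkN) (Int.natCast_dvd.mpr hkD)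

/-! ## §2 FD‴: FD″ with `p ∤ h_K`, granted Beckwith–Raum–Richter 2022 Thm. 1 -/

/-- **FD‴ = FD″ ∧ `p ∤ h_K`.** For every globally minimal `W/ℚ`, prime `p ≥ 5` with `ClassX7 W p` and `Surj W p`, granted modularity
with parametrisation AND the named fact `BRR2022_thm_1`: K1″'s frame data `(K, ι, v, v̄, κ₁, κ₂, γ₁, γ₂, N, f, d, W′, C, N′, f′)` with the
base-change splitting package and the canonical `γ₁` — the statement of
`SignedBaseChangeK1FrameDataCanonical.stub_frameDataBCSsplit_canonical` VERBATIM — and, appended, `¬ p ∣ NumberField.classNumber K`.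
Proof: the twist prime `ℓ ≡ 1 (mod 8)`, `ℓ > N + p`, with residues prescribed at `p` and at the odd primes of `N`
(`exists_prime_one_mod_eight_prescribed`); then `K` from
`BiquadraticEisensteinDescentHeegnerFieldSupplyEvenRung.exists_twoSplit_split_not_dvd_classNumber` with `S = {p, ℓ} ∪ (odd primes of N)`:
`d_K ≡ 1 (mod 8)` gives `2` split, `d_K` odd, `d_K ≠ −3`; split odd primes do not divide `d_K`, so `(N, d_K) = 1` and `ℓ ∤ d_K`.
CONDITIONAL on `BRR2022_thm_1`. [cite: BeckwithRaumRichter2022, Thm. 1] -/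
theorem frameDataBCSsplit_canonical_coprime (h22 : BRR2022_thm_1) : Literature.NumberTheory.EllipticCurves.ModularForms.nonempty_modularParametrizationData → ∀ (W : WeierstrassCurve ℚ) [W.IsElliptic] [W.IsGloballyMinimal] (p : ℕ) [Fact p.Prime], 5 ≤ p → Literature.NumberTheory.EllipticCurves.Rank1Residual.ClassX7 W p → Literature.NumberTheory.EllipticCurves.Rank1Residual.Surj W p → ∃ (K : Type) (_ : Field K) (_ : NumberField K) (ι : PadicAlgCl p ≃+* ℂ) (v vbar : IsDedekindDomain.HeightOneSpectrum (NumberField.RingOfIntegers K)) (κ₁ κ₂ : Literature.NumberTheory.EllipticCurves.ZpExtension K p) (γ₁ γ₂ : Field.absoluteGaloisGroup K) (_ : Fact (Literature.NumberTheory.EllipticCurves.ZpExtension.IsTopGeneratorPair κ₁ κ₂ γ₁ γ₂)) (_ : NeZero (NumberField.discr K).natAbs) (N : ℕ) (_ : NeZero N) (f : CuspForm (CongruenceSubgroup.Gamma0 N) 2) (d : ℤ) (W' : WeierstrassCurve ℚ) (_ : W'.IsElliptic) (_ : W'.IsGloballyMinimal) (C : WeierstrassCurve.VariableChange ℚ)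 (N' : ℕ) (_ : NeZero N') (f' : CuspForm (CongruenceSubgroup.Gamma0 N') 2), Literature.NumberTheory.EllipticCurves.ModularForms.IsNewformOf W f ∧ (N : ℤ) = W.conductorNorm ℤ ∧ Literature.NumberTheory.EllipticCurves.ModularForms.IsNewformOf W' f' ∧ (N' : ℤ) = W'.conductorNorm ℤ ∧ Squarefree d ∧ 1 < d ∧ (∀ q : ℕ, q.Prime → Literature.NumberTheory.EllipticCurves.BurungaleSkinnerTianWan2024.RamifiedInQuadratic d q → q ≠ p ∧ ¬ q ∣ N ∧ ¬ (q : ℤ) ∣ NumberField.discr K) ∧ C • W' = W.quadraticTwist (d : ℚ) ∧ Literature.NumberTheory.EllipticCurves.IsImaginaryQuadratic K ∧ ((Ideal.span {(p : ℤ)}).primesOver (NumberField.RingOfIntegers K)).ncard = 2 ∧ ((p : ℕ) : NumberField.RingOfIntegers K) ∈ v.asIdeal ∧ ((p : ℕ) : NumberField.RingOfIntegers K) ∈ vbar.asIdeal ∧ vbar ≠ v ∧ (∀ (w : NumberField.InfinitePlace K) (k : NumberField.RingOfIntegers K), k ∈ v.asIdeal ↔ ‖ι.symm (w.embedding (k :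 K))‖ < 1) ∧ IsCoprime (N : ℤ) (NumberField.discr K) ∧ (∀ ρ : Literature.NumberTheory.GaloisRepresentations.ModPGaloisRep K (ZMod p) 2, (W.baseChange K).IsTorsionGaloisRep p ρ → Literature.NumberTheory.GaloisRepresentations.FramedRep.IsAbsolutelyIrreducible ρ) ∧ κ₁.IsCyclotomic ∧ κ₂.IsAnticyclotomic ∧ (∃ ζ : ℤ_[p]ˣ, IsOfFinOrder ζ ∧ ((Literature.NumberTheory.GaloisRepresentations.GaloisRep.cyclotomicCharacter K p γ₁ * ζ : ℤ_[p]ˣ) : ℤ_[p]) = (Literature.NumberTheory.EllipticCurves.cyclotomicGenerator p : ℤ_[p])) ∧ (∀ ℓ : ℕ, ℓ.Prime → ℓ ∣ N → ((Ideal.span {(ℓ : ℤ)}).primesOver (NumberField.RingOfIntegers K)).ncard = 2) ∧ ((Ideal.span {(2 : ℤ)}).primesOver (NumberField.RingOfIntegers K)).ncard = 2 ∧ (Odd (NumberField.discr K) ∧ NumberField.discr K ≠ -3) ∧ d % 8 = 1 ∧ (∀ ℓ : ℕ, ℓ.Prime → (ℓ : ℤ) ∣ d → ((Ideal.span {(ℓ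 : ℤ)}).primesOver (NumberField.RingOfIntegers K)).ncard = 2) ∧ (((d : ℤ) : ZMod p) ≠ 0 ∧ IsSquare ((d : ℤ) : ZMod p)) ∧ (∀ ℓ : ℕ, ℓ.Prime → ℓ ∣ N → ℓ ≠ 2 → ((d : ℤ) : ZMod ℓ) ≠ 0 ∧ (IsSquare ((d : ℤ) : ZMod ℓ) ↔ ¬ p ∣ ℓ + 1)) ∧ ¬ p ∣ NumberField.classNumber K := by
  intro hmodP W _ _ p _ hp hX hs
  have hpP : p.Prime := Fact.out
  have hp2 : p ≠ 2 := by omega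
  -- the newform of `W`; `p ∤ N` (good reduction at `p`)
  haveI hN0 : NeZero (W.conductorNorm ℤ) := ⟨(WeierstrassCurve.conductorNorm_pos_holds W).ne'⟩
  obtain ⟨D⟩ := hmodP W
  set N : ℕ := W.conductorNorm ℤ with hNdef
  have hpN : ¬ p ∣ N := not_dvd_conductorNorm_of_hasGoodReductionAtPrime W hX.1.1
  -- §1 the twist prime `ℓ`: residues prescribed at `p` and at the odd primes of `N`
  set A : Finset ℕ := insert p ((N.primeFactors.erase 2).filter (fun ℓ ↦ ¬ p ∣ ℓ + 1)) with hAdef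
  set B : Finset ℕ := (N.primeFactors.erase 2).filter (fun ℓ ↦ p ∣ ℓ + 1) with hBdef
  have hmemE : ∀ ℓ ∈ N.primeFactors.erase 2, ℓ.Prime ∧ ℓ ≠ 2 ∧ ℓ ∣ N := fun ℓ hℓ ↦ by
    rw [Finset.mem_erase, Nat.mem_primeFactors] at hℓ
    exact ⟨hℓ.2.1, hℓ.1, hℓ.2.2.1⟩
  have hA : ∀ a ∈ A, a.Prime ∧ a ≠ 2 := fun a ha ↦ by
    rw [hAdef, Finset.mem_insert] at ha
    rcases ha with rfl | ha
    · exact ⟨hpP, hp2⟩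
    · rw [Finset.mem_filter] at ha
      exact ⟨(hmemE a ha.1).1, (hmemE a ha.1).2.1⟩
  have hB : ∀ b ∈ B, b.Prime ∧ b ≠ 2 := fun b hb ↦ by
    rw [hBdef, Finset.mem_filter] at hb
    exact ⟨(hmemE b hb.1).1, (hmemE b hb.1).2.1⟩
  have hAB : Disjoint A B := by
    rw [Finset.disjoint_left]
    intro a haA haB
    rw [hAdef, Finset.mem_insert] at haA
    rw [hBdef, Finset.mem_filter] at haB
    rcases haA with rfl | haA
    · exact hpN (hmemE _ haB.1).2.2
    · rw [Finset.mem_filter] at haA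
      exact haA.2 haB.2
  obtain ⟨ℓ, hℓ, hℓgt, -, -, hℓ8, hℓA, hℓB⟩ := exists_prime_one_mod_eight_prescribed A B hA hB hAB (N + p)
  have hℓ4 : ℓ ≡ 1 [MOD 4] := by unfold Nat.ModEq; omega
  have hℓ2 : ℓ ≠ 2 := by intro h; unfold Nat.ModEq at hℓ4; omega
  -- the field: `2`, `p`, `ℓ` and the odd primes of `N` split, AND `p ∤ h_K` (Beckwith–Raum–Richter 2022)
  set S : Finset ℕ := insert p (insert ℓ (N.primeFactors.erase 2)) with hSdef
  have hS : ∀ q ∈ S, q.Prime ∧ q ≠ 2 := by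
    intro q hq
    rw [hSdef, Finset.mem_insert, Finset.mem_insert] at hq
    rcases hq with rfl | rfl | hq
    · exact ⟨hpP, hp2⟩
    · exact ⟨hℓ, hℓ2⟩
    · exact ⟨(hmemE q hq).1, (hmemE q hq).2.1⟩
  obtain ⟨K, _, _, h2K, htc, -, hd8, hsplit2, hsplitT, hcl⟩ :=
    Summit.BirchSwinnertonDyer.BirchSwinnertonDyer.Theorems.BiquadraticEisensteinDescentHeegnerFieldSupplyEvenRung.exists_twoSplit_split_not_dvd_classNumber
      h22 hpP (by omega) S hS 0
  have hK : IsImaginaryQuadratic K := ⟨h2K, htc⟩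
  have hodd : Odd (NumberField.discr K) := by rw [Int.odd_iff]; omega
  have hne3 : NumberField.discr K ≠ -3 := by omega
  have hTN : ∀ l : ℕ, l.Prime → l ∣ N →
      ((Ideal.span {(l : ℤ)}).primesOver (𝓞 K)).ncard = 2 := by
    intro l hl hlN
    by_cases hl2 : l = 2
    · subst hl2; exact_mod_cast hsplit2
    · refine hsplitT l ?_
      rw [hSdef, Finset.mem_insert, Finset.mem_insert, Finset.mem_erase, Nat.mem_primeFactors]
      exact Or.inr (Or.inr ⟨hl2, hl, hlN, hN0.out⟩)
  have hsplit : ((Ideal.span {(p : ℤ)}).primesOver (𝓞 K)).ncard = 2 :=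
    hsplitT p (by rw [hSdef]; exact Finset.mem_insert_self _ _)
  have hsplitℓ : ((Ideal.span {(ℓ : ℤ)}).primesOver (𝓞 K)).ncard = 2 :=
    hsplitT ℓ (by rw [hSdef]; exact Finset.mem_insert_of_mem (Finset.mem_insert_self _ _))
  have hcopN : IsCoprime (N : ℤ) (NumberField.discr K) :=
    isCoprime_natCast_discr_of_forall_split h2K hodd hTN
  have hℓdK : ¬ (ℓ : ℤ) ∣ NumberField.discr K :=
    not_intCast_dvd_discr_of_ncard_primesOver_eq_two h2K hℓ hℓ2 hsplitℓ
  -- places above `p`, embedding datum, tower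
  obtain ⟨v, vbar, hv, hvbar, hne⟩ := exists_pair_of_ncard_primesOver_eq_two hpP hsplit
  obtain ⟨ι, hι⟩ := exists_iota hK v hv
  obtain ⟨κ₁, κ₂, γ₁, γ₂, hpair, hcyc, hanti, hcan⟩ :=
    exists_isTopGeneratorPair_isCyclotomic_isAnticyclotomic_canonical (p := p) hK hp2
  haveI : Fact (ZpExtension.IsTopGeneratorPair κ₁ κ₂ γ₁ γ₂) := ⟨hpair⟩
  haveI : NeZero (NumberField.discr K).natAbs := ⟨Int.natAbs_ne_zero.mpr (NumberField.discr_ne_zero K)⟩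
  -- the twist `W^{(ℓ)}` and its minimal model
  have hℓ0 : ((ℓ : ℤ) : ℚ) ≠ 0 := by exact_mod_cast hℓ.ne_zero
  haveI := W.isElliptic_quadraticTwist hℓ0
  obtain ⟨C₀, hC₀⟩ := WeierstrassCurve.hasGlobalMinimalModel_rat_holds (W.quadraticTwist ((ℓ : ℤ) : ℚ))
  haveI : (C₀ • W.quadraticTwist ((ℓ : ℤ) : ℚ)).IsGloballyMinimal := hC₀
  haveI hN0' : NeZero ((C₀ • W.quadraticTwist ((ℓ : ℤ) : ℚ)).conductorNorm ℤ) :=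
    ⟨(WeierstrassCurve.conductorNorm_pos_holds _).ne'⟩
  obtain ⟨D'⟩ := hmodP (C₀ • W.quadraticTwist ((ℓ : ℤ) : ℚ))
  refine ⟨K, inferInstance, inferInstance, ι, v, vbar, κ₁, κ₂, γ₁, γ₂, inferInstance, inferInstance, N,
    inferInstance, D.f, (ℓ : ℤ), C₀ • W.quadraticTwist ((ℓ : ℤ) : ℚ), inferInstance, hC₀, C₀⁻¹,
    (C₀ • W.quadraticTwist ((ℓ : ℤ) : ℚ)).conductorNorm ℤ, inferInstance, D'.f, D.isNewformOf, rfl,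
    D'.isNewformOf, rfl, ?_, ?_, ?_, inv_smul_smul C₀ _, hK, hsplit, hv, hvbar, hne, hι, hcopN, ?_, hcyc, hanti,
    hcan, hTN, hsplit2, ⟨hodd, hne3⟩, ?_, ?_, ?_, ?_, hcl⟩
  · -- `ℓ` square-free
    exact Int.squarefree_natCast.mpr hℓ.squarefree
  · -- `1 < ℓ`
    exact_mod_cast hℓ.one_lt
  · -- ramified in `ℚ(√ℓ)` only at `ℓ`, and `ℓ ∤ p N d_K`
    intro q' hq' hram
    obtain rfl := eq_of_ramifiedInQuadratic hℓ hℓ4 hq' hram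
    refine ⟨by omega, fun h ↦ ?_, hℓdK⟩
    exact absurd (Nat.le_of_dvd (Nat.pos_of_ne_zero hN0.out) h) (by omega)
  · -- (irr_K), framed
    exact fun ρ hρ ↦ irrK_framed_of_surj W p hp2 hs K hK.1 ρ hρ
  · -- `d ≡ 1 (mod 8)`
    omega
  · -- the primes of `d = ℓ` split in `K`
    intro l hl hdvd
    obtain rfl : l = ℓ := (Nat.prime_dvd_prime_iff_eq hl hℓ).mp (Int.natCast_dvd_natCast.mp hdvd)
    exact hsplitℓ
  · -- `d ≡ 1` is a non-zero square mod `p` (`p` SPLIT in `ℚ(√d)`)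
    rw [Int.cast_natCast, hℓA p (by rw [hAdef]; exact Finset.mem_insert_self _ _)]
    exact ⟨one_ne_zero, ⟨1, (mul_one 1).symm⟩⟩
  · -- odd `ℓ' ∣ N`: `d` a non-zero square mod `ℓ'` iff `p ∤ ℓ' + 1`
    intro l hl hlN hl2
    haveI : Fact l.Prime := ⟨hl⟩
    have hlE : l ∈ N.primeFactors.erase 2 := by
      rw [Finset.mem_erase, Nat.mem_primeFactors]; exact ⟨hl2, hl, hlN, hN0.out⟩
    rw [Int.cast_natCast]
    by_cases hpl : p ∣ l + 1
    · have hlB : l ∈ B := by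
        rw [hBdef, Finset.mem_filter]; exact ⟨hlE, hpl⟩
      obtain ⟨hne0, hnsq⟩ := hℓB l hlB
      exact ⟨hne0, iff_of_false hnsq (not_not.mpr hpl)⟩
    · have hlA : l ∈ A := by
        rw [hAdef, Finset.mem_insert, Finset.mem_filter]; exact Or.inr ⟨hlE, hpl⟩
      rw [hℓA l hlA]
      exact ⟨one_ne_zero, iff_of_true ⟨1, (mul_one 1).symm⟩ hpl⟩

/-! ## §3 K1″ from ES and the crux WITH the binder `¬ p ∣ h_K` -/

/-- **K1″ ⇐ ES ∧ AED⁺, modulo BCS 2025 Prop. 4.2.2 (guarded) and BRR 2022 Thm. 1.** `hES` = the consequent of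
`TwoVariableEulerSystemDivisibility` (text verbatim, as in p536497 §5); `hdiv` = the consequent of the crux
`AnticyclotomicEisensteinDivisibility` WITH `¬ p ∣ NumberField.classNumber K →` inserted after `κ₂.IsAnticyclotomic →` (AED⁺).
Proof: p536497 §5 verbatim with FD‴ supplying the witnesses — both factors `W`, `W^{(d)}` are fed at the SAME field `K`, whose class
number is prime to `p` — and `G⁻ ≠ 0` from `acMu_of_prop422`. CONDITIONAL; nothing about BSD is proved.
[cite: BeckwithRaumRichter2022, Thm. 1] [cite: BurungaleCastellaSkinner2025, Prop. 4.2.2] -/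
theorem twistPairGreenbergProductDivisibilityCanonical_of_eulerSystem_of_acDivCoprime
    (h22 : BRR2022_thm_1)
    (h422 : Literature.NumberTheory.EllipticCurves.BurungaleCastellaSkinner2025.prop422_greenbergAnyRoot_hasUnitContent_minus)
    (hES : Literature.NumberTheory.EllipticCurves.ModularForms.nonempty_modularParametrizationData → ∀ (W : WeierstrassCurve ℚ) [W.IsElliptic] [W.IsGloballyMinimal] (p : ℕ) [Fact p.Prime], 5 ≤ p → W.HasGoodReductionAtPrime p → Literature.NumberTheory.EllipticCurves.Rank1Residual.Surj W p → ∀ (K : Type) [Field K] [NumberField K] (ι : PadicAlgCl p ≃+* ℂ) (v vbar : IsDedekindDomain.HeightOneSpectrum (NumberField.RingOfIntegers K)) (κ₁ κ₂ : ZpExtension K p) (γ₁ γ₂ : Field.absoluteGaloisGroup K) [Fact (ZpExtension.IsTopGeneratorPair κ₁ κ₂ γ₁ γ₂)] [NeZero (NumberField.discr K).natAbs] (N : ℕ) [NeZero N] (f : CuspForm (CongruenceSubgroup.Gamma0 N) 2), IsNewformOf W f → (N : ℤ) = W.conductorNorm ℤ → IsImaginaryQuadratic K → ((Ideal.span {(p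 : ℤ)}).primesOver (NumberField.RingOfIntegers K)).ncard = 2 → ((p : ℕ) : NumberField.RingOfIntegers K) ∈ v.asIdeal → ((p : ℕ) : NumberField.RingOfIntegers K) ∈ vbar.asIdeal → vbar ≠ v → (∀ (w : NumberField.InfinitePlace K) (k : NumberField.RingOfIntegers K), k ∈ v.asIdeal ↔ ‖ι.symm (w.embedding (k : K))‖ < 1) → IsCoprime (N : ℤ) (NumberField.discr K) → (∀ ℓ : ℕ, ℓ.Prime → ℓ ∣ N → ((Ideal.span {(ℓ : ℤ)}).primesOver (NumberField.RingOfIntegers K)).ncard = 2) → Odd (NumberField.discr K) → NumberField.discr K ≠ -3 → κ₁.IsCyclotomic → κ₂.IsAnticyclotomic → ∀ (Ω δ : ℂ) (Ωp : (unrIntegers p)ˣ) (LK G : PowerSeries (PowerSeries (PadicComplexInt p))), Ω ≠ 0 → (δ ^ 2 = (NumberField.discr K : ℂ) ∨ δ ^ 2 = -(NumberField.discr K : ℂ)) → IsKatzMeasure₂ ι v vbar ∅ κ₁ κ₂ γ₁⁻¹ γ₂⁻¹ 1 Ω δ ((Ωp : unrIntegers p) : PadicComplex p) LK → IsGreenbergLFunctionAnyRoot₂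 ι v vbar κ₁ κ₂ γ₁⁻¹ γ₂⁻¹ f (NumberField.discr K).natAbs (NumberField.classNumber K) LK G → ∀ J : ℤ_[p] →+* PadicComplexInt p, (∀ x : ℤ_[p], ((J x : PadicComplexInt p) : PadicComplex p) = ((x : ℚ_[p]) : PadicComplex p)) → Ideal.span {G} ≤ (WeierstrassCurve.XGr₂.charIdeal (W.baseChange K) p κ₁ κ₂ vbar γ₁ γ₂).map (IwasawaAlgebra₂.toUnr₂ p J))
    (hdiv : Literature.NumberTheory.EllipticCurves.ModularForms.nonempty_modularParametrizationData → ∀ (W : WeierstrassCurve ℚ) [W.IsElliptic] [W.IsGloballyMinimal] (p : ℕ) [Fact p.Prime], 5 ≤ p → W.HasGoodReductionAtPrime p → Literature.NumberTheory.EllipticCurves.Rank1Residual.Surj W p → ∀ (K : Type) [Field K] [NumberField K] (ι : PadicAlgCl p ≃+* ℂ) (v vbar : IsDedekindDomain.HeightOneSpectrum (NumberField.RingOfIntegers K)) (κ₁ κ₂ : Literature.NumberTheory.EllipticCurves.ZpExtension K p) (γ₁ γ₂ : Field.absoluteGaloisGroup K) [Fact (Literature.NumberTheory.EllipticCurves.ZpExtension.IsTopGeneratorPair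 κ₁ κ₂ γ₁ γ₂)] [NeZero (NumberField.discr K).natAbs] (N : ℕ) [NeZero N] (f : CuspForm (CongruenceSubgroup.Gamma0 N) 2), Literature.NumberTheory.EllipticCurves.ModularForms.IsNewformOf W f → (N : ℤ) = W.conductorNorm ℤ → Literature.NumberTheory.EllipticCurves.IsImaginaryQuadratic K → ((Ideal.span {(p : ℤ)}).primesOver (NumberField.RingOfIntegers K)).ncard = 2 → ((p : ℕ) : NumberField.RingOfIntegers K) ∈ v.asIdeal → ((p : ℕ) : NumberField.RingOfIntegers K) ∈ vbar.asIdeal → vbar ≠ v → (∀ (w : NumberField.InfinitePlace K) (k : NumberField.RingOfIntegers K), k ∈ v.asIdeal ↔ ‖ι.symm (w.embedding (k : K))‖ < 1) → IsCoprime (N : ℤ) (NumberField.discr K) → (∀ ℓ : ℕ, ℓ.Prime → ℓ ∣ N → ((Ideal.span {(ℓ : ℤ)}).primesOver (NumberField.RingOfIntegers K)).ncard = 2) → Odd (NumberField.discr K) → NumberField.discr K ≠ -3 → κ₁.IsCyclotomic → κ₂.IsAnticyclotomic → ¬ p ∣ NumberField.classNumber K → ∀ (Ω δ : ℂ) (Ωp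 : (Literature.NumberTheory.EllipticCurves.unrIntegers p)ˣ) (LK G : PowerSeries (PowerSeries (PadicComplexInt p))), Ω ≠ 0 → (δ ^ 2 = (NumberField.discr K : ℂ) ∨ δ ^ 2 = -(NumberField.discr K : ℂ)) → Literature.NumberTheory.EllipticCurves.IsKatzMeasure₂ ι v vbar ∅ κ₁ κ₂ γ₁⁻¹ γ₂⁻¹ 1 Ω δ ((Ωp : Literature.NumberTheory.EllipticCurves.unrIntegers p) : PadicComplex p) LK → Literature.NumberTheory.EllipticCurves.IsGreenbergLFunctionAnyRoot₂ ι v vbar κ₁ κ₂ γ₁⁻¹ γ₂⁻¹ f (NumberField.discr K).natAbs (NumberField.classNumber K) LK G → ∀ J : ℤ_[p] →+* PadicComplexInt p, (∀ x : ℤ_[p], ((J x : PadicComplexInt p) : PadicComplex p) = ((x : ℚ_[p]) : PadicComplex p)) → ((WeierstrassCurve.XGr₂.charIdeal (W.baseChange K) p κ₁ κ₂ vbar γ₁ γ₂).map (Literature.NumberTheory.EllipticCurves.IwasawaAlgebra₂.toUnr₂ p J)).map (PowerSeries.constantCoeff (R := PowerSeries (PadicComplexInt p))) ≤ Ideal.span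 {Literature.NumberTheory.EllipticCurves.UnrSeries₂.minus G}) :
    TwistPairGreenbergProductDivisibilityCanonical := by
  intro _ hmodP W _ _ p _ hp hX hs
  obtain ⟨K, iF, iNF, ι, v, vbar, κ₁, κ₂, γ₁, γ₂, iPair, iD, N, iN, f, d, W', iE', iM', C, N', iN', f',
      h0, h1, h2, h3, h4, h5, h6, h7, h8, h9, h10, h11, h12, h13, h14, h15, h16, h17, hcan,
      e1, e2, e3, e4, e5, e6, e7, hh⟩ :=
    frameDataBCSsplit_canonical_coprime h22 hmodP W p hp hX hs
  have hgood : W.HasGoodReductionAtPrime p := hX.1.1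
  have hgood' : W'.HasGoodReductionAtPrime p :=
    Summit.BirchSwinnertonDyer.BirchSwinnertonDyer.Theorems.SignedBaseChangeK2RFrames.hasGoodReductionAtPrime_of_smul_eq_quadraticTwist_of_not_ramifiedInQuadratic
      W W' h7 Fact.out hgood (fun hr ↦ (h6 p Fact.out hr).1 rfl)
  have hs' : Literature.NumberTheory.EllipticCurves.Rank1Residual.Surj W' p :=
    surj_of_smul_eq_quadraticTwist W W' p h5 h7 hs
  have h14' : IsCoprime (N' : ℤ) (NumberField.discr K) :=
    Summit.BirchSwinnertonDyer.BirchSwinnertonDyer.Theorems.SignedBaseChangeK2RFrames.isCoprime_conductorNorm_twist_discr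
      W W' h7 h1 h3 (fun q hq hr ↦ ⟨(h6 q hq hr).2.1, (h6 q hq hr).2.2⟩) h14
  have e1' := heegner_twist W W' h7 h1 h3 (K := K) e1 e5 e2
  refine ⟨K, iF, iNF, ι, v, vbar, κ₁, κ₂, γ₁, γ₂, iPair, iD, N, iN, f, d, W', iE', iM', C, N', iN', f',
    h0, h1, h2, h3, h4, h5, h6, h7, h8, h9, h10, h11, h12, h13, h14, e1, e5, e2, h15, h16, h17, hcan, ?_⟩
  intro Ω δ Ωp LK G G' hΩ hδ hLK hG hG' J hJ
  have hμW := acMu_of_prop422 h422 hmodP W p hp hgood hs K ι v vbar κ₁ κ₂ γ₁ γ₂ N f h0 h1 h8 h9 h10 h11 h12 h13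
    h14 e1 e3.1 e3.2 h16 h17 Ω δ Ωp LK G hΩ hδ hLK hG J hJ
  have hμW' := acMu_of_prop422 h422 hmodP W' p hp hgood' hs' K ι v vbar κ₁ κ₂ γ₁ γ₂ N' f' h2 h3 h8 h9 h10 h11
    h12 h13 h14' e1' e3.1 e3.2 h16 h17 Ω δ Ωp LK G' hΩ hδ hLK hG' J hJ
  have hdivW := hdiv hmodP W p hp hgood hs K ι v vbar κ₁ κ₂ γ₁ γ₂ N f h0 h1 h8 h9 h10 h11 h12 h13 h14 e1
    e3.1 e3.2 h16 h17 hh Ω δ Ωp LK G hΩ hδ hLK hG J hJ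
  have hdivW' := hdiv hmodP W' p hp hgood' hs' K ι v vbar κ₁ κ₂ γ₁ γ₂ N' f' h2 h3 h8 h9 h10 h11 h12 h13 h14'
    e1' e3.1 e3.2 h16 h17 hh Ω δ Ωp LK G' hΩ hδ hLK hG' J hJ
  have hA : (WeierstrassCurve.XGr₂.charIdeal (W.baseChange K) p κ₁ κ₂ vbar γ₁ γ₂).map
      (IwasawaAlgebra₂.toUnr₂ p J) ≤ Ideal.span {G} :=
    map_le_span_of_anchor (charIdealIsPrincipal₂ p _) J
      (hES hmodP W p hp hgood hs K ι v vbar κ₁ κ₂ γ₁ γ₂ N f h0 h1 h8 h9 h10 h11 h12 h13 h14 e1 e3.1 e3.2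
        h16 h17 Ω δ Ωp LK G hΩ hδ hLK hG J hJ) hμW hdivW
  have hB : (WeierstrassCurve.XGr₂.charIdeal (W'.baseChange K) p κ₁ κ₂ vbar γ₁ γ₂).map
      (IwasawaAlgebra₂.toUnr₂ p J) ≤ Ideal.span {G'} :=
    map_le_span_of_anchor (charIdealIsPrincipal₂ p _) J
      (hES hmodP W' p hp hgood' hs' K ι v vbar κ₁ κ₂ γ₁ γ₂ N' f' h2 h3 h8 h9 h10 h11 h12 h13 h14' e1'
        e3.1 e3.2 h16 h17 Ω δ Ωp LK G' hΩ hδ hLK hG' J hJ) hμW' hdivW'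
  exact ⟨1, one_ne_zero, span_C_one_mul_mul_le hA hB⟩

/-- **The closer for the restated crux: `BRR2022_thm_1 → AED⁺ → TwoVariableEulerSystemDivisibility →
TwistPairGreenbergProductDivisibilityCanonical`** (AED⁺ = the crux with the binder `¬ p ∣ h_K`; the antecedent
`SignedTwoVariableInputs` by name). Same shape as `SignedBaseChangeRev14Glue.twistPairGreenbergProductDivisibilityCanonical_of_acanchorChildren`
(p541190) / `SignedBaseChangeAcanchorGlueCloser.twistPairCanonicalAcanchorGlue_holds`, with conjunct 1 of `SignedTwoVariableInputs`
(BCS 2025 Prop. 4.2.2, guarded) feeding `G⁻ ≠ 0`. CONDITIONAL; nothing about BSD is proved.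
[cite: BeckwithRaumRichter2022, Thm. 1] [cite: BurungaleCastellaSkinner2025, Prop. 4.2.2] -/
theorem twistPairGreenbergProductDivisibilityCanonical_of_acDivCoprime (h22 : BRR2022_thm_1)
    (hD : SignedTwoVariableInputs → Literature.NumberTheory.EllipticCurves.ModularForms.nonempty_modularParametrizationData → ∀ (W : WeierstrassCurve ℚ) [W.IsElliptic] [W.IsGloballyMinimal] (p : ℕ) [Fact p.Prime], 5 ≤ p → W.HasGoodReductionAtPrime p → Literature.NumberTheory.EllipticCurves.Rank1Residual.Surj W p → ∀ (K : Type) [Field K] [NumberField K] (ι : PadicAlgCl p ≃+* ℂ) (v vbar : IsDedekindDomain.HeightOneSpectrum (NumberField.RingOfIntegers K)) (κ₁ κ₂ : Literature.NumberTheory.EllipticCurves.ZpExtension K p) (γ₁ γ₂ : Field.absoluteGaloisGroup K) [Fact (Literature.NumberTheory.EllipticCurves.ZpExtension.IsTopGeneratorPair κ₁ κ₂ γ₁ γ₂)] [NeZero (NumberField.discr K).natAbs] (N : ℕ) [NeZero N] (f : CuspForm (CongruenceSubgroup.Gamma0 N) 2), Literature.NumberTheory.EllipticCurves.ModularForms.IsNewformOf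 W f → (N : ℤ) = W.conductorNorm ℤ → Literature.NumberTheory.EllipticCurves.IsImaginaryQuadratic K → ((Ideal.span {(p : ℤ)}).primesOver (NumberField.RingOfIntegers K)).ncard = 2 → ((p : ℕ) : NumberField.RingOfIntegers K) ∈ v.asIdeal → ((p : ℕ) : NumberField.RingOfIntegers K) ∈ vbar.asIdeal → vbar ≠ v → (∀ (w : NumberField.InfinitePlace K) (k : NumberField.RingOfIntegers K), k ∈ v.asIdeal ↔ ‖ι.symm (w.embedding (k : K))‖ < 1) → IsCoprime (N : ℤ) (NumberField.discr K) → (∀ ℓ : ℕ, ℓ.Prime → ℓ ∣ N → ((Ideal.span {(ℓ : ℤ)}).primesOver (NumberField.RingOfIntegers K)).ncard = 2) → Odd (NumberField.discr K) → NumberField.discr K ≠ -3 → κ₁.IsCyclotomic → κ₂.IsAnticyclotomic → ¬ p ∣ NumberField.classNumber K → ∀ (Ω δ : ℂ) (Ωp : (Literature.NumberTheory.EllipticCurves.unrIntegers p)ˣ) (LK G : PowerSeries (PowerSeries (PadicComplexInt p))), Ω ≠ 0 → (δ ^ 2 = (NumberField.discr K : ℂ) ∨ δ ^ 2 = -(NumberField.discr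 K : ℂ)) → Literature.NumberTheory.EllipticCurves.IsKatzMeasure₂ ι v vbar ∅ κ₁ κ₂ γ₁⁻¹ γ₂⁻¹ 1 Ω δ ((Ωp : Literature.NumberTheory.EllipticCurves.unrIntegers p) : PadicComplex p) LK → Literature.NumberTheory.EllipticCurves.IsGreenbergLFunctionAnyRoot₂ ι v vbar κ₁ κ₂ γ₁⁻¹ γ₂⁻¹ f (NumberField.discr K).natAbs (NumberField.classNumber K) LK G → ∀ J : ℤ_[p] →+* PadicComplexInt p, (∀ x : ℤ_[p], ((J x : PadicComplexInt p) : PadicComplex p) = ((x : ℚ_[p]) : PadicComplex p)) → ((WeierstrassCurve.XGr₂.charIdeal (W.baseChange K) p κ₁ κ₂ vbar γ₁ γ₂).map (Literature.NumberTheory.EllipticCurves.IwasawaAlgebra₂.toUnr₂ p J)).map (PowerSeries.constantCoeff (R := PowerSeries (PadicComplexInt p))) ≤ Ideal.span {Literature.NumberTheory.EllipticCurves.UnrSeries₂.minus G})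
    (hE : TwoVariableEulerSystemDivisibility) :
    TwistPairGreenbergProductDivisibilityCanonical :=
  fun hIn ↦ twistPairGreenbergProductDivisibilityCanonical_of_eulerSystem_of_acDivCoprime h22 hIn.1 (hE hIn) (hD hIn) hIn

end Summit.BirchSwinnertonDyer.BirchSwinnertonDyer.Theorems.SignedBaseChangeAcDivCoprimeClassNumber

end
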